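import Summits.BirchSwinnertonDyer.Rank1Residual.P2.CongruentNumberSilentEvenFiveGenusParity
import Summits.BirchSwinnertonDyer.Rank1Residual.P2.CongruentNumberSilentEvenFiveSelmerEightAoki
import Literature.NumberTheory.QuadraticFields.RedeiReichardtFourRank
import HarnessLib

/-!
# Cell «bsd-monsky» (prover-B): route B's corner with Aoki 1999 for the `2`-Selmer row —
# C-P2-1 (both forms) on `𝒮⁻`, and every `q ≡ 3 (mod 8)` pair, from {`thetaGenusPointDatum`, Aoki Thm 2.2}

HONEST FRAMING (cell `bsd-monsky`, run/shared/lean/pub/bsd-monsky/; README §1: ONE theorem on ONE explicit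
infinite family of quadratic twists of the congruent number curve at the prime `2`; not "BSD for rank ≤ 1",
nothing at odd primes, nothing booked until the cross-family referee passes the written proof). Every door
here is CONDITIONAL on named hypotheses; the two conjecture `Prop`s of C-P2-1 stay `@[conjecture]`.

WHAT THIS FILE ADDS — one-line compositions. Route B's `𝒮⁻` doors without the Rédei–Reichardt binder
(`P2/CongruentNumberSilentEvenFiveGenusParity.lean`: `…_of_thetaDisplay_of_selmer_le_eight (hΘ) (hSel)`) take the
`2`-Selmer bound `#Sel₂(E_{2pq}) ≤ 8` as an explicit input `hSel`; prover-A's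
`P2/CongruentNumberSilentEvenFiveSelmerEightAoki.lean` supplies it — with equality, on the whole even-five family —
from Aoki 1999 Thm. 2.2 (`Aoki1999.thm22_card_selmerGroup_two`, `hAo`: a refereed theorem with complete printed
proofs, evaluated in the kernel on `n = 2pq`: `selmer_le_eight_of_aoki`, `card_selmerGroup_two_two_mul_five_mul_of_aoki`).
Composing the two:

* `theoremB_of_thetaGenusPointDatum_of_aoki (hΘ) (hAo)` (Theorem B in the hook's `hThmB` shape, all pairs) and
  `odd_scriptL_sMinus_of_thetaDisplay_of_aoki` («`𝓛(2pq)` odd» on `𝒮⁻`);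
* `congruentSilentEvenFiveOrdTwo_of_thetaDisplay_of_aoki (hΘ) (hAo)`, `congruentSilentEvenFiveBSDTwo_of_thetaDisplay_of_aoki
  (hΘ) (hAo)` — C-P2-1 in both forms on all of `𝒮⁻` from {display, Aoki};
* `analyticRank_eq_one_and_bsdp_two_three_mod_eight_of_thetaDisplay_of_aoki (hΘ) (hAo)` — `ord_{s=1} = 1 ∧ BSD(E_{2pq}, 2)`
  for every `p ≡ 5 (mod 8)`, `q ≡ 3 (mod 8)`, either symbol (PROOF-B §10 rows);
* `forall_bsdp_two_congruentNumberCurve_two_mul_five_mul_of_thetaDisplay_of_aoki (hTYZ hGZK hAo hΘ)` — `BSD(E_{2pq}, 2)` on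
  the WHOLE even-five family from four binders, the Rédei–Reichardt binder of prover-A's `(p/q) = +1` door being
  instantiated by the theorem `redeiReichardt_fourTwoCard_classGroup_holds` (`QuadraticFields/RedeiReichardtFourRank.lean`).

ROUTE B'S FACT SET for C-P2-1 thereby reads {`thetaGenusPointDatum` (= `thetaCMDatum`, (D1)–(D7); the route's one
obligation node), Aoki 1999 Thm. 2.2}: no Heath-Brown 1994 / Monsky sketch (`hMe`), no Rédei–Reichardt, no GZK binder,
no Monsky 1990 (honest framing of "no GZK binder" as in `…ThetaDescentRank.lean`: the displayed TYZ Thm 3.5 is proved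
in print with Gross–Zagier + Kolyvagin). Nothing booked; no mark moved.

References: [Aoki1999] N. Aoki, Comment. Math. Univ. St. Pauli 48 (1999), Thm. 2.2 p. 81; [TianYuanZhang2017] Thm. 3.5,
§1 (1.1); [Miller2011LMS] Def. 1.1; HOME/proof/PROOF-B.md (v1.3) §8–§10.
-/

noncomputable section

open scoped Classical

open WeierstrassCurve Literature.NumberTheory.EllipticCurves
  Literature.NumberTheory.EllipticCurves.Aoki1999
  Literature.NumberTheory.EllipticCurves.Rank1Residual
  Literature.NumberTheory.EllipticCurves.Rank1Residual.Typed
  Literature.NumberTheory.EllipticCurves.HeathBrown1994.Families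
  Literature.NumberTheory.EllipticCurves.TianYuanZhang2017
  Literature.NumberTheory.QuadraticFields.RedeiReichardt

set_option autoImplicit false

namespace Summit.BirchSwinnertonDyer.Rank1Residual.P2

open ThetaDescent Conjectures

/-- **THEOREM B in tree currency from the display and Aoki 1999 Thm. 2.2, ALL pairs** (the hook's `hThmB` shape): for all
primes `p ≡ 5 (mod 8)`, `q ≡ 3 (mod 4)`, `g(2pq)` odd ⟹ `∃ L` odd with `IsScriptL (2pq) L`; rank input `#Sel₂(E_{2pq}) = 8`
from `card_selmerGroup_two_two_mul_five_mul_of_aoki`. No `hMe`, no GZK binder, no Monsky 1990. CONDITIONAL; nothing asserted.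
[cite: Aoki1999, Thm. 2.2 p. 81] [cite: TianYuanZhang2017, Thm. 3.5 and §3] -/
theorem theoremB_of_thetaGenusPointDatum_of_aoki
    (hΘ : ∀ p q : ℕ, p.Prime → q.Prime → p % 8 = 5 → q % 4 = 3 → thetaGenusPointDatum p q)
    (hAo : thm22_card_selmerGroup_two) :
    ∀ p q : ℕ, p.Prime → q.Prime → p % 8 = 5 → q % 4 = 3 →
      Odd (genusClassNumber (GenusField (2 * (p * q)))) → ∃ L : ℤ, Odd L ∧ IsScriptL (2 * (p * q)) L := by
  intro p q hp hq hp5 hq4 hg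
  obtain ⟨D, hD, θ, hθ⟩ := hΘ p q hp hq hp5 hq4
  have hN0 : 2 * (p * q) ≠ 0 := Nat.mul_ne_zero two_ne_zero (Nat.mul_ne_zero hp.ne_zero hq.ne_zero)
  have hn1 : 1 < 2 * (p * q) := by
    have := Nat.mul_pos hp.pos hq.pos; omega
  refine ⟨D.scriptL (2 * (p * q)), odd_scriptL_of_thetaSpec_of_card_selmerGroup_two_le_eight hp hq hp5 hq4
    D hD θ hθ hg (card_selmerGroup_two_two_mul_five_mul_of_aoki hAo hp hq hp5 hq4).le, ?_⟩
  exact hD.1 _ (Nat.mem_divisors_self _ hN0) hn1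

/-- **«`𝓛(2pq)` odd» on all of `𝒮⁻` from {display, Aoki 1999 Thm. 2.2}** — the hypothesis `hB` of the hook's
`congruentSilentEvenFiveOrdTwo_of_odd_scriptL`; `g(2pq)` odd on `𝒮⁻` is the kernel theorem
`odd_gK_two_mul_five_mul_of_jacobiSym_neg`. CONDITIONAL; nothing asserted. [cite: Aoki1999, Thm. 2.2 p. 81]
[cite: TianYuanZhang2017, Thm. 3.5 and §3] -/
theorem odd_scriptL_sMinus_of_thetaDisplay_of_aoki
    (hΘ : ∀ p q : ℕ, p.Prime → q.Prime → p % 8 = 5 → q % 4 = 3 → thetaGenusPointDatum p q)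
    (hAo : thm22_card_selmerGroup_two) :
    ∀ p q : ℕ, p.Prime → q.Prime → p % 8 = 5 → q % 4 = 3 → jacobiSym p q = -1 →
      ∃ L : ℤ, Odd L ∧ IsScriptL (2 * (p * q)) L :=
  odd_scriptL_sMinus_of_thetaDisplay_of_selmer_le_eight hΘ (selmer_le_eight_of_aoki hAo)

/-- **Route B ⟹ C-P2-1, sharper (`Ш_an`-unit) form, from {display, Aoki 1999 Thm. 2.2}** — the `hSel` door fed with
`selmer_le_eight_of_aoki`. CONDITIONAL; nothing asserted. [cite: Aoki1999, Thm. 2.2 p. 81]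
[cite: TianYuanZhang2017, §1 ((1.1)), Thm. 3.5] [cite: Miller2011LMS, Def. 1.1 (arXiv:1010.2431 p. 3)] -/
theorem congruentSilentEvenFiveOrdTwo_of_thetaDisplay_of_aoki
    (hΘ : ∀ p q : ℕ, p.Prime → q.Prime → p % 8 = 5 → q % 4 = 3 → thetaGenusPointDatum p q)
    (hAo : thm22_card_selmerGroup_two) : CongruentSilentEvenFiveOrdTwo :=
  congruentSilentEvenFiveOrdTwo_of_thetaDisplay_of_selmer_le_eight hΘ (selmer_le_eight_of_aoki hAo)

/-- **Route B ⟹ C-P2-1, OBSERVABLE form (`ord_{s=1} L(E_{2pq}, s) = 1 ∧ BSD(E_{2pq}, 2)` on all of `𝒮⁻`) from TWO named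
inputs {`thetaGenusPointDatum`, Aoki 1999 Thm. 2.2}** — no `hMe`, no Rédei–Reichardt, no GZK binder, no Monsky 1990.
CONDITIONAL; nothing asserted. [cite: Aoki1999, Thm. 2.2 p. 81] [cite: TianYuanZhang2017, Thm. 3.5 and §1 (1.1)]
[cite: Miller2011LMS, Def. 1.1 (arXiv:1010.2431 p. 3)] -/
theorem congruentSilentEvenFiveBSDTwo_of_thetaDisplay_of_aoki
    (hΘ : ∀ p q : ℕ, p.Prime → q.Prime → p % 8 = 5 → q % 4 = 3 → thetaGenusPointDatum p q)
    (hAo : thm22_card_selmerGroup_two) : CongruentSilentEvenFiveBSDTwo :=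
  congruentSilentEvenFiveBSDTwo_of_thetaDisplay_of_selmer_le_eight hΘ (selmer_le_eight_of_aoki hAo)

/-- **Route B from {`thetaCMDatum` (D1)–(D7), Aoki 1999 Thm. 2.2} ⟹ C-P2-1, observable form** — the display pushed down
to the CM points. CONDITIONAL; nothing asserted. [cite: Aoki1999, Thm. 2.2 p. 81]
[cite: TianYuanZhang2017, Prop. 3.2 (2), Thm. 3.6 (1)(2), Lemma 3.18, Thm. 3.5] -/
theorem congruentSilentEvenFiveBSDTwo_of_thetaCMDatum_of_aoki
    (hΘ : ∀ p q : ℕ, p.Prime → q.Prime → p % 8 = 5 → q % 4 = 3 → thetaCMDatum p q)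
    (hAo : thm22_card_selmerGroup_two) : CongruentSilentEvenFiveBSDTwo :=
  congruentSilentEvenFiveBSDTwo_of_thetaDisplay_of_aoki
    (fun p q hp hq hp5 hq4 => thetaGenusPointDatum_of_thetaCMDatum hp hq (hΘ p q hp hq hp5 hq4)) hAo

/-- **`ord_{s=1} L(E_{2pq}, s) = 1 ∧ BSD(E_{2pq}, 2)` for EVERY `p ≡ 5 (mod 8)`, `q ≡ 3 (mod 8)`, either symbol, from
{display, Aoki 1999 Thm. 2.2}** (PROOF-B §10 rows; `#Sel₂ = 8` by `card_selmerGroup_two_two_mul_five_mul_of_aoki`).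
CONDITIONAL; nothing asserted. [cite: Aoki1999, Thm. 2.2 p. 81] [cite: TianYuanZhang2017, §1 ((1.1)), Thm. 3.5]
[cite: Miller2011LMS, Def. 1.1 (arXiv:1010.2431 p. 3)] -/
theorem analyticRank_eq_one_and_bsdp_two_three_mod_eight_of_thetaDisplay_of_aoki
    (hΘ : ∀ p q : ℕ, p.Prime → q.Prime → p % 8 = 5 → q % 4 = 3 → thetaGenusPointDatum p q)
    (hAo : thm22_card_selmerGroup_two) {p q : ℕ} (hp : p.Prime) (hq : q.Prime) (hp5 : p % 8 = 5)
    (hq3 : q % 8 = 3) :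
    (congruentNumberCurve (2 * (p * q))).analyticRank = 1 ∧ BSDp (congruentNumberCurve (2 * (p * q))) 2 :=
  analyticRank_eq_one_and_bsdp_two_three_mod_eight_of_thetaDisplay_of_selmer_le_eight hΘ
    (fun _ _ hp' hq' hp5' hq3' => (card_selmerGroup_two_two_mul_five_mul_of_aoki hAo hp' hq' hp5' (by omega)).le)
    hp hq hp5 hq3

/-- **`BSD(E_{2pq}, 2)` for ALL primes `p ≡ 5 (mod 8)`, `q ≡ 3 (mod 4)` from {`hTYZ`, `hGZK`, Aoki 1999 Thm. 2.2, the
`θ`-display}** — the whole even-five two-prime family with NO Rédei–Reichardt binder (the theorem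
`redeiReichardt_fourTwoCard_classGroup_holds` instantiates it inside prover-A's `(p/q) = +1` door
`bsdp_two_congruentNumberCurve_two_mul_five_mul_of_aoki`), NO `hMe` / Heath-Brown 1994, NO `h515` / Monsky 1990, NO
Tian-2014 system: TYZ §3 data + GZK decide `(p/q) = +1` (U⁺, TYZ Thm 1.2), route B's `θ`-descent decides `𝒮⁻`, Aoki's
closed formula gives every `2`-Selmer row. CONDITIONAL on the four binders; nothing asserted; no mark moved.
[cite: TianYuanZhang2017, Thm. 1.2, Thm. 3.5 and §1 (1.1)] [cite: Aoki1999, Thm. 2.2 p. 81]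
[cite: Miller2011LMS, Def. 1.1 (arXiv:1010.2431 p. 3)] [cite: LiMa2008, Thm. 0.4] -/
theorem forall_bsdp_two_congruentNumberCurve_two_mul_five_mul_of_thetaDisplay_of_aoki
    (hTYZ : tyz_genusPointData) (hGZK : rank_eq_analyticRank_of_analyticRank_le_one)
    (hAo : thm22_card_selmerGroup_two)
    (hΘ : ∀ p q : ℕ, p.Prime → q.Prime → p % 8 = 5 → q % 4 = 3 → thetaGenusPointDatum p q) :
    ∀ p q : ℕ, p.Prime → q.Prime → p % 8 = 5 → q % 4 = 3 →
      BSDp (congruentNumberCurve (2 * (p * q))) 2 := by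
  intro p q hp hq hp5 hq4
  have hne : p ≠ q := fun h => by omega
  rcases jacobiSym.eq_one_or_neg_one (int_gcd_eq_one_of_primes hp hq hne) with hj | hj
  · exact (bsdp_two_congruentNumberCurve_two_mul_five_mul_of_aoki hTYZ hGZK
      redeiReichardt_fourTwoCard_classGroup_holds hAo hp hq hp5 hq4 hj).2
  · exact (congruentSilentEvenFiveBSDTwo_of_thetaDisplay_of_aoki hΘ hAo p q hp hq hp5 hq4 hj).2

/-- **The same from the CM-level display** {`hTYZ`, `hGZK`, Aoki 1999 Thm. 2.2, `thetaCMDatum` (D1)–(D7)}. CONDITIONAL;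
nothing asserted. [cite: TianYuanZhang2017, Thm. 1.2, Prop. 3.2 (2), Thm. 3.6 (1)(2), Lemma 3.18, Thm. 3.5]
[cite: Aoki1999, Thm. 2.2 p. 81] -/
theorem forall_bsdp_two_congruentNumberCurve_two_mul_five_mul_of_thetaCMDatum_of_aoki
    (hTYZ : tyz_genusPointData) (hGZK : rank_eq_analyticRank_of_analyticRank_le_one)
    (hAo : thm22_card_selmerGroup_two)
    (hΘ : ∀ p q : ℕ, p.Prime → q.Prime → p % 8 = 5 → q % 4 = 3 → thetaCMDatum p q) :
    ∀ p q : ℕ, p.Prime → q.Prime → p % 8 = 5 → q % 4 = 3 →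
      BSDp (congruentNumberCurve (2 * (p * q))) 2 :=
  forall_bsdp_two_congruentNumberCurve_two_mul_five_mul_of_thetaDisplay_of_aoki hTYZ hGZK hAo
    (fun p q hp hq hp5 hq4 => thetaGenusPointDatum_of_thetaCMDatum hp hq (hΘ p q hp hq hp5 hq4))

end Summit.BirchSwinnertonDyer.Rank1Residual.P2

end
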